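/-
Literature anchor (engines group, cap lane, anchor #17): Gröbner's Lie series and the Taylor
coefficient maps of a polynomial vector field; discharges the analytic hypotheses of
`Literature.Analysis.ODE.highOrderEnclosure_step` (Lohner's one-step enclosure theorem) for
polynomial right-hand sides.
-/
import Mathlib.RingTheory.Derivation.Basic
import Mathlib.Algebra.MvPolynomial.PDeriv
import Mathlib.Algebra.MvPolynomial.CommRing
import Mathlib.RingTheory.PowerSeries.Basic
import Mathlib.RingTheory.PowerSeries.Derivative
import Mathlib.Data.Nat.Choose.Sum
import Mathlib.Algebra.BigOperators.NatAntidiagonal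
import Mathlib.Analysis.Calculus.FDeriv.Mul
import Mathlib.Analysis.Calculus.FDeriv.Prod
import Mathlib.Analysis.Calculus.FDeriv.Pi
import Mathlib.Analysis.Calculus.MeanValue
import Literature.Analysis.ODE.HighOrderEnclosure
import HarnessLib

/-!
# Lie series and the Taylor coefficients of a polynomial vector field

For a derivation `D` of a commutative `𝕜`-algebra `A` (`char 𝕜 = 0`) the **Lie series** of
`a ∈ A` is the formal power series `∑ₖ (k!)⁻¹ Dᵏ a · Xᵏ = exp (X·D) a`
[cite: HairerWannerLubich2002, §III.5.1 eqs. (5.3)–(5.4)].  Its coefficients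
`lieCoeff D k a = (k!)⁻¹ Dᵏ a` obey the two rules on which R. E. Moore's recursive generation of
Taylor coefficients ("automatic differentiation") rests: the shift rule
`(k+1) · lieCoeff D (k+1) a = lieCoeff D k (D a)` [cite: Moore1979, §3.4 eq. (3.17)] and the
Leibniz/Cauchy-product rule `lieCoeff D n (a b) = ∑_{i+j=n} lieCoeff D i a · lieCoeff D j b`
[cite: Moore1979, §3.4 eq. (3.18)].  Consequently `a ↦ lieSeries D a` is a `𝕜`-algebra
homomorphism `A →ₐ[𝕜] A⟦X⟧`, which is Gröbner's *Vertauschungssatz*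
`exp(XD) F(g) = F(exp(XD) g)` for polynomial `F`
[cite: HairerWannerLubich2002, §III.5.1 Lemma 5.1 and the remark following it (Gröbner 1960)], and
`d/dX (lieSeries D a) =
lieSeries D (D a)`.

For a polynomial vector field `p : ι → 𝕜[X_ι]` and its Lie derivative
`L_p = ∑ᵢ pᵢ ∂ᵢ` [cite: HairerWannerLubich2002, §III.5.1 eq. (5.2)] the polynomials
`taylorPoly p k i = lieCoeff L_p k Xᵢ` are the Taylor coefficient maps of the flow of
`y' = p(y)`: the Lie series `∑ₖ taylorPoly p k · tᵏ` is the formal solution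
[cite: HairerWannerLubich2002, §III.5.1 Lemma 5.1, eq. (5.3)].  Over `𝕜 = ℝ` we prove that the
evaluated maps `taylorMap p k : (ι → ℝ) → (ι → ℝ)` are Fréchet differentiable with the explicit
derivative `∑ⱼ (∂ⱼ q)(x) · projⱼ`, satisfy the recurrence
`D(taylorMap p k)(x) · p(x) = (k+1) · taylorMap p (k+1) x` — hypothesis `hrec` of
`highOrderEnclosure_step` — and have bounded derivative / are Lipschitz on bounded convex sets.
The final corollary `highOrderEnclosure_step_polynomial` is Lohner's constant high-order
enclosure step [cite: NedialkovJacksonPryce2001, §3 (HOE existence test)] for polynomial fields with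
*all*
analytic side conditions discharged: only the order `K ≥ 1`, a bounded convex candidate set `S`,
the a-priori box `[c, d] ∋ taylorMap p K (S)` and the inclusion test remain as hypotheses.

This is the algebraic core of the Taylor-model / Lohner IVP engines (Moore 1966/1979,
Lohner 1987, Berz–Makino 1998, Nedialkov–Jackson–Corliss 1999 §5): the coefficient recurrences
are exact identities in the polynomial ring, so a validated integrator only has to enclose their
floating-point evaluation.

Not formalised here: non-polynomial elementary functions (Moore's rules (3.19) for
`exp, log, sin, …` need analytic composition), and convergence of the Lie series (only the formal
series and finitely many coefficient maps are used by the enclosure step).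

Related tree files (not imported, different objects): `Literature.AlgebraicGeometry.Resolution.
KollarMCInvariantTaylor` proves the same folklore Leibniz rule for `δ^[n]` (`Function.iterate`
form) and a truncated exponential `taylorTrunc` modulo `ξ^N` inside the resolution-of-
singularities topic — `iterDer_mul` below re-proves the rule in `LinearMap`-power form to keep
this file's import closure inside `Analysis/ODE`; `Literature.Analysis.Calculus.MvPolynomialFDeriv`
differentiates `MvPolynomial.eval` on `EuclideanSpace ℝ (Fin n)`, whereas the enclosure theorem
needs the sup-norm Pi type `ι → ℝ`; `Literature.Algebra.Lie.TruncatedLieSeries` treats KAM Lie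
transforms `e^{ε^p ad u}`, not flows of vector fields.
-/

noncomputable section

open Finset Set Metric
open scoped Nat NNReal Topology

namespace Literature.Analysis.ODE

/-! ## §A. Lie coefficients and the Lie series of a derivation -/

section LieCoeff

variable {𝕜 : Type*} [Field 𝕜] {A : Type*} [CommRing A] [Algebra 𝕜 A]
  (D : Derivation 𝕜 A A)

/-- The `k`-fold iterate `Dᵏ` of a derivation, as a `𝕜`-linear map (the operators in
`exp(tD) = ∑ₖ tᵏ/k! Dᵏ`). [cite: HairerWannerLubich2002, §III.5.1 eq. (5.3)] -/
def iterDer (k : ℕ) : A →ₗ[𝕜] A := (D : A →ₗ[𝕜] A) ^ k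

/-- `D⁰ a = a` (the `k = 0` term of `exp(tD) = ∑ tᵏ/k! Dᵏ`).
[cite: HairerWannerLubich2002, §III.5.1 eq. (5.3)] -/
@[simp] theorem iterDer_zero (a : A) : iterDer D 0 a = a := by
  simp [iterDer]

/-- `D^{k+1} a = D^k (D a)` (iterated Lie derivative).
[cite: HairerWannerLubich2002, §III.5.1 eq. (5.3)] -/
theorem iterDer_succ (k : ℕ) (a : A) : iterDer D (k + 1) a = iterDer D k (D a) := by
  simp [iterDer, pow_succ, Module.End.mul_apply]

/-- `D^{k+1} a = D (D^k a)` (iterated Lie derivative).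
[cite: HairerWannerLubich2002, §III.5.1 eq. (5.3)] -/
theorem iterDer_succ' (k : ℕ) (a : A) : iterDer D (k + 1) a = D (iterDer D k a) := by
  simp [iterDer, pow_succ', Module.End.mul_apply]

/-- `D` kills the scalars, hence so do all positive iterates (`(u)_j = 0`, `j ≥ 1`, for a
constant `u`). [cite: Moore1979, §3.4, remark after (3.18)] -/
theorem iterDer_succ_algebraMap (k : ℕ) (c : 𝕜) : iterDer D (k + 1) (algebraMap 𝕜 A c) = 0 := by
  rw [iterDer_succ, Derivation.map_algebraMap, map_zero]

/-- **General Leibniz rule** for the iterates of a derivation: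
`Dⁿ(ab) = ∑_{i+j=n} C(n,i) Dⁱa · Dʲb` (cf. `Derivation.iterate_apply_mul_eq_sum` in
`Literature.AlgebraicGeometry.Resolution.KollarMCInvariantTaylor`, iterate form); the binomial
form of Moore's product rule (3.18). [cite: Moore1979, §3.4 eq. (3.18)] -/
theorem iterDer_mul (n : ℕ) (a b : A) :
    iterDer D n (a * b) =
      ∑ ij ∈ antidiagonal n, n.choose ij.1 • (iterDer D ij.1 a * iterDer D ij.2 b) := by
  induction n with
  | zero => simp
  | succ n ih =>
    rw [iterDer_succ', ih, map_sum,
      Finset.sum_antidiagonal_choose_succ_nsmul (fun i j => iterDer D i a * iterDer D j b) n]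
    have h2 : ∑ ij ∈ antidiagonal n, n.choose ij.2 • (iterDer D (ij.1 + 1) a * iterDer D ij.2 b)
        = ∑ ij ∈ antidiagonal n, n.choose ij.1 • (iterDer D (ij.1 + 1) a * iterDer D ij.2 b) := by
      refine Finset.sum_congr rfl fun ij hij => ?_
      rw [← Nat.choose_symm_of_eq_add (mem_antidiagonal.mp hij).symm]
    rw [h2, ← Finset.sum_add_distrib]
    refine Finset.sum_congr rfl fun ij _ => ?_
    rw [map_nsmul, Derivation.leibniz, smul_eq_mul, smul_eq_mul, ← iterDer_succ', ← iterDer_succ',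
      ← smul_add, mul_comm (iterDer D ij.2 b) (iterDer D (ij.1 + 1) a)]

/-- The `k`-th **Lie coefficient** (normalised Taylor coefficient) `(k!)⁻¹ Dᵏ a` of `a` along the
derivation `D`. [cite: Moore1979, §3.4 eq. (3.17)]
[cite: HairerWannerLubich2002, §III.5.1 eq. (5.3)] -/
def lieCoeff (k : ℕ) (a : A) : A := ((k ! : 𝕜)⁻¹) • iterDer D k a

/-- `lieCoeff D 0 a = a`, i.e. `(x)₀ = x(t₀)`. [cite: Moore1979, §3.4 eq. (3.13)] -/
@[simp] theorem lieCoeff_zero_apply (a : A) : lieCoeff D 0 a = a := by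
  simp [lieCoeff]

/-- Additivity of the Lie coefficients (Moore's rule for `u + v`).
[cite: Moore1979, §3.4 eq. (3.18)] -/
theorem lieCoeff_add (k : ℕ) (a b : A) :
    lieCoeff D k (a + b) = lieCoeff D k a + lieCoeff D k b := by
  simp [lieCoeff, smul_add]

/-- Homogeneity of the Lie coefficients: `(u v)_k = u (v)_k` for a constant `u`.
[cite: Moore1979, §3.4, remark after (3.18)] -/
theorem lieCoeff_smul (k : ℕ) (c : 𝕜) (a : A) :
    lieCoeff D k (c • a) = c • lieCoeff D k a := by
  simp only [lieCoeff, map_smul]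
  rw [smul_comm]

/-- `lieCoeff D k 0 = 0` (the constant `0`). [cite: Moore1979, §3.4, remark after (3.18)] -/
@[simp] theorem lieCoeff_apply_zero (k : ℕ) : lieCoeff D k (0 : A) = 0 := by
  simp [lieCoeff]

/-- Positive Lie coefficients of a scalar vanish: `(u)_j = 0` for `j ≥ 1` if `u` is constant.
[cite: Moore1979, §3.4, remark after (3.18)] -/
theorem lieCoeff_succ_algebraMap (k : ℕ) (c : 𝕜) :
    lieCoeff D (k + 1) (algebraMap 𝕜 A c) = 0 := by
  simp [lieCoeff, iterDer_succ_algebraMap]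

/-- Positive Lie coefficients of `1` vanish. [cite: Moore1979, §3.4, remark after (3.18)] -/
theorem lieCoeff_succ_one (k : ℕ) : lieCoeff D (k + 1) (1 : A) = 0 := by
  simpa using lieCoeff_succ_algebraMap D k (1 : 𝕜)

/-- A derivation commutes with its own Lie coefficients: `D (lieCoeff D k a) = lieCoeff D k (D a)`
(`D` commutes with `exp(tD)`). [cite: HairerWannerLubich2002, §III.5.1 eq. (5.3)] -/
theorem apply_lieCoeff (k : ℕ) (a : A) : D (lieCoeff D k a) = lieCoeff D k (D a) := by
  unfold lieCoeff
  rw [Derivation.map_smul, ← iterDer_succ', iterDer_succ]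

/-- The **Lie series** `∑ₖ (k!)⁻¹ Dᵏ a · Xᵏ = exp(X D) a` of `a` along `D`, as a formal power series
over `A`. [cite: HairerWannerLubich2002, §III.5.1 eqs. (5.3)–(5.4)] -/
def lieSeries (a : A) : PowerSeries A := PowerSeries.mk fun k => lieCoeff D k a

/-- Coefficients of the Lie series. [cite: HairerWannerLubich2002, §III.5.1 eq. (5.3)] -/
@[simp] theorem coeff_lieSeries (k : ℕ) (a : A) :
    PowerSeries.coeff k (lieSeries D a) = lieCoeff D k a := by
  rw [lieSeries, PowerSeries.coeff_mk]

/-- The Lie series is additive. [cite: Moore1979, §3.4 eq. (3.18)] -/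
theorem lieSeries_add (a b : A) : lieSeries D (a + b) = lieSeries D a + lieSeries D b := by
  ext n
  simp [lieCoeff_add]

/-- `exp(XD) 1 = 1`. [cite: HairerWannerLubich2002, §III.5.1 eq. (5.4)] -/
theorem lieSeries_one : lieSeries D (1 : A) = 1 := by
  ext n
  cases n with
  | zero => simp [PowerSeries.coeff_one]
  | succ k => simp [PowerSeries.coeff_one, lieCoeff_succ_one]

/-- `exp(XD) c = c` for scalars `c`. [cite: HairerWannerLubich2002, §III.5.1 eq. (5.4)] -/
theorem lieSeries_algebraMap (c : 𝕜) :
    lieSeries D (algebraMap 𝕜 A c) = algebraMap 𝕜 (PowerSeries A) c := by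
  ext n
  rw [PowerSeries.algebraMap_apply, PowerSeries.coeff_C, coeff_lieSeries]
  cases n with
  | zero => simp
  | succ k => simp [lieCoeff_succ_algebraMap]

variable [CharZero 𝕜]

/-- **Moore's shift rule** (the recursion generating Taylor coefficients):
`(k+1) · lieCoeff D (k+1) a = lieCoeff D k (D a)`, i.e. the `(k+1)`-st Taylor coefficient of `y` is
`1/(k+1)` times the `k`-th Taylor coefficient of `y' = D y`. [cite: Moore1979, §3.4 eq. (3.17)] -/
theorem lieCoeff_succ (k : ℕ) (a : A) :
    (k + 1) • lieCoeff D (k + 1) a = lieCoeff D k (D a) := by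
  unfold lieCoeff
  rw [← iterDer_succ, ← Nat.cast_smul_eq_nsmul 𝕜, smul_smul, Nat.factorial_succ]
  congr 1
  have hk : (k ! : 𝕜) ≠ 0 := by exact_mod_cast Nat.factorial_ne_zero k
  have hk1 : ((k + 1 : ℕ) : 𝕜) ≠ 0 := by exact_mod_cast Nat.succ_ne_zero k
  push_cast at hk1 ⊢
  field_simp

/-- `(n!)⁻¹ · C(n,i) = (i!)⁻¹ (j!)⁻¹` for `i + j = n`. [folklore] -/
private lemma factorial_inv_mul_choose {i j n : ℕ} (h : i + j = n) :
    ((n ! : 𝕜))⁻¹ * (n.choose i : 𝕜) = ((i ! : 𝕜))⁻¹ * ((j ! : 𝕜))⁻¹ := by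
  subst h
  have hnat : ((i + j).choose i : 𝕜) * (i ! : 𝕜) * (j ! : 𝕜) = ((i + j)! : 𝕜) := by
    rw [Nat.choose_symm_add]
    exact_mod_cast Nat.add_choose_mul_factorial_mul_factorial i j
  have hi : (i ! : 𝕜) ≠ 0 := by exact_mod_cast Nat.factorial_ne_zero i
  have hj : (j ! : 𝕜) ≠ 0 := by exact_mod_cast Nat.factorial_ne_zero j
  have hc : ((i + j).choose i : 𝕜) ≠ 0 := by
    exact_mod_cast (Nat.choose_pos (Nat.le_add_right i j)).ne'
  rw [← hnat]
  field_simp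

/-- **Leibniz / Cauchy-product rule** for Lie coefficients (Moore's rule for `u · v`):
`lieCoeff D n (ab) = ∑_{i+j=n} lieCoeff D i a · lieCoeff D j b`.
[cite: Moore1979, §3.4 eq. (3.18)] -/
theorem lieCoeff_mul (n : ℕ) (a b : A) :
    lieCoeff D n (a * b) = ∑ ij ∈ antidiagonal n, lieCoeff D ij.1 a * lieCoeff D ij.2 b := by
  unfold lieCoeff
  rw [iterDer_mul, Finset.smul_sum]
  refine Finset.sum_congr rfl fun ij hij => ?_
  rw [← Nat.cast_smul_eq_nsmul 𝕜, smul_smul, smul_mul_smul_comm,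
    factorial_inv_mul_choose (mem_antidiagonal.mp hij)]

/-- The Lie series is multiplicative: `exp(XD)(ab) = exp(XD)a · exp(XD)b` — the Cauchy product
form of the Leibniz rule. [cite: Moore1979, §3.4 eq. (3.18)]
[cite: HairerWannerLubich2002, §III.5.1 Lemma 5.1 (Gröbner 1960)] -/
theorem lieSeries_mul (a b : A) : lieSeries D (a * b) = lieSeries D a * lieSeries D b := by
  ext n
  rw [coeff_lieSeries, PowerSeries.coeff_mul, lieCoeff_mul]
  simp only [coeff_lieSeries]

/-- **Gröbner's exchange theorem (Vertauschungssatz), algebra-hom form**: `a ↦ exp(XD) a` is a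
`𝕜`-algebra homomorphism `A →ₐ[𝕜] A⟦X⟧`, hence commutes with every polynomial expression.
[cite: HairerWannerLubich2002, §III.5.1 Lemma 5.1 and eq. (5.4) (Gröbner 1960)] -/
def lieSeriesAlgHom : A →ₐ[𝕜] PowerSeries A where
  toFun := lieSeries D
  map_one' := lieSeries_one D
  map_mul' := lieSeries_mul D
  map_zero' := by ext n; simp
  map_add' := lieSeries_add D
  commutes' := lieSeries_algebraMap D

/-- `lieSeriesAlgHom D a = lieSeries D a`. [cite: HairerWannerLubich2002, §III.5.1 eq. (5.4)] -/
@[simp] theorem lieSeriesAlgHom_apply (a : A) : lieSeriesAlgHom D a = lieSeries D a := rfl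

/-- **Vertauschungssatz**: for a polynomial `F` in variables `s : σ` and elements `g s ∈ A`,
`exp(XD) (F(g)) = F(exp(XD) g)`.
[cite: HairerWannerLubich2002, §III.5.1 eq. (5.4), Vertauschungssatz remark after Lemma 5.1] -/
theorem lieSeries_aeval {σ : Type*} (g : σ → A) (F : MvPolynomial σ 𝕜) :
    lieSeries D (MvPolynomial.aeval g F) =
      MvPolynomial.aeval (fun s => lieSeries D (g s)) F := by
  simpa using MvPolynomial.comp_aeval_apply (f := g) (lieSeriesAlgHom D) F

/-- **The Lie series solves the flow equation formally**: `d/dX exp(XD) a = exp(XD) (D a)`.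
[cite: HairerWannerLubich2002, §III.5.1 proof of Lemma 5.1] -/
theorem derivative_lieSeries (a : A) :
    PowerSeries.derivative A (lieSeries D a) = lieSeries D (D a) := by
  ext n
  rw [PowerSeries.coeff_derivative, coeff_lieSeries, coeff_lieSeries, ← lieCoeff_succ,
    nsmul_eq_mul, Nat.cast_succ, mul_comm]

end LieCoeff

/-! ## §B. The Lie derivative of a polynomial vector field and its Taylor polynomials -/

section Polynomial

variable {𝕜 : Type*} [Field 𝕜] {ι : Type*} [Fintype ι]

/-- The **Lie derivative** `L_p = ∑ᵢ pᵢ ∂ᵢ` along the polynomial vector field `p`, a derivation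
of the polynomial ring `𝕜[Xᵢ : i ∈ ι]`. [cite: HairerWannerLubich2002, §III.5.1 eq. (5.2)] -/
def lieDerivation (p : ι → MvPolynomial ι 𝕜) :
    Derivation 𝕜 (MvPolynomial ι 𝕜) (MvPolynomial ι 𝕜) :=
  ∑ i, p i • MvPolynomial.pderiv i

/-- `L_p q = ∑ᵢ pᵢ · ∂ᵢ q`. [cite: HairerWannerLubich2002, §III.5.1 eq. (5.2)] -/
theorem lieDerivation_apply (p : ι → MvPolynomial ι 𝕜) (q : MvPolynomial ι 𝕜) :
    lieDerivation p q = ∑ i, p i * MvPolynomial.pderiv i q := by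
  unfold lieDerivation
  rw [← Derivation.coeFnAddMonoidHom_apply, map_sum, Finset.sum_apply]
  simp [Derivation.coeFnAddMonoidHom_apply, Derivation.smul_apply, smul_eq_mul]

/-- `L_p Xᵢ = pᵢ`: the Lie derivative of a coordinate is the corresponding component of the
field. [cite: HairerWannerLubich2002, §III.5.1 eq. (5.2)] -/
@[simp] theorem lieDerivation_X (p : ι → MvPolynomial ι 𝕜) (i : ι) :
    lieDerivation p (MvPolynomial.X i) = p i := by
  classical
  rw [lieDerivation_apply]
  simp [MvPolynomial.pderiv_X, Pi.single_apply]

variable [CharZero 𝕜]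

/-- The **Taylor coefficient polynomials** of the flow of `y' = p(y)`:
`taylorPoly p k i = (k!)⁻¹ L_pᵏ Xᵢ`, so that `y(t) = ∑ₖ taylorPoly p k (y₀) tᵏ` formally.
[cite: HairerWannerLubich2002, §III.5.1 Lemma 5.1, eq. (5.3)]
[cite: Moore1979, §3.4 eqs. (3.13)–(3.17)] -/
def taylorPoly (p : ι → MvPolynomial ι 𝕜) (k : ℕ) (i : ι) : MvPolynomial ι 𝕜 :=
  lieCoeff (lieDerivation p) k (MvPolynomial.X i)

omit [CharZero 𝕜] in
/-- Zeroth Taylor polynomial = the coordinate itself (`(x)₀ = x(t₀)`).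
[cite: Moore1979, §3.4 eq. (3.13)] -/
@[simp] theorem taylorPoly_zero (p : ι → MvPolynomial ι 𝕜) (i : ι) :
    taylorPoly p 0 i = MvPolynomial.X i := by
  simp [taylorPoly]

/-- First Taylor polynomial = the field component: `taylorPoly p 1 i = pᵢ`.
[cite: Moore1979, §3.4 eq. (3.15)] -/
theorem taylorPoly_one (p : ι → MvPolynomial ι 𝕜) (i : ι) : taylorPoly p 1 i = p i := by
  have h := lieCoeff_succ (lieDerivation p) 0 (MvPolynomial.X i)
  simp only [zero_add, one_smul, lieCoeff_zero_apply, lieDerivation_X] at h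
  simpa [taylorPoly] using h

/-- **Moore's recursion for the Taylor polynomials of the flow**:
`(k+1) · taylorPoly p (k+1) i = lieCoeff L_p k (pᵢ)` — the `(k+1)`-st coefficient of `yᵢ` is
`1/(k+1)` times the `k`-th coefficient of `pᵢ(y)`, the latter computable from the coefficients
of order `≤ k` by the sum/product rules `lieCoeff_add`, `lieCoeff_mul`.
[cite: Moore1979, §3.4 eqs. (3.15)–(3.18)] -/
theorem taylorPoly_succ (p : ι → MvPolynomial ι 𝕜) (k : ℕ) (i : ι) :
    (k + 1) • taylorPoly p (k + 1) i = lieCoeff (lieDerivation p) k (p i) := by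
  rw [taylorPoly, lieCoeff_succ, lieDerivation_X]

/-- The same recursion with the Lie derivative applied to the `k`-th Taylor polynomial:
`L_p (taylorPoly p k i) = (k+1) · taylorPoly p (k+1) i`. [cite: Moore1979, §3.4 eq. (3.17)] -/
theorem lieDerivation_taylorPoly (p : ι → MvPolynomial ι 𝕜) (k : ℕ) (i : ι) :
    lieDerivation p (taylorPoly p k i) = (k + 1) • taylorPoly p (k + 1) i := by
  rw [taylorPoly_succ, taylorPoly, apply_lieCoeff, lieDerivation_X]

/-- **Lemma 5.1 of Hairer–Lubich–Wanner (Gröbner), formal version**: the Lie series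
`Yᵢ = ∑ₖ taylorPoly p k i · Xᵏ = exp(X L_p) Xᵢ` satisfies the differential equation
`d/dX Yᵢ = pᵢ(Y)` in `𝕜[X_ι]⟦X⟧`. [cite: HairerWannerLubich2002, §III.5.1 Lemma 5.1] -/
theorem derivative_lieSeries_X (p : ι → MvPolynomial ι 𝕜) (i : ι) :
    PowerSeries.derivative (MvPolynomial ι 𝕜) (lieSeries (lieDerivation p) (MvPolynomial.X i)) =
      MvPolynomial.aeval (fun s => lieSeries (lieDerivation p) (MvPolynomial.X s)) (p i) := by
  rw [derivative_lieSeries, lieDerivation_X, ← lieSeries_aeval, MvPolynomial.aeval_X_left_apply]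

omit [CharZero 𝕜] in
/-- Coefficients of the Lie series of a coordinate are the Taylor polynomials.
[cite: HairerWannerLubich2002, §III.5.1 eq. (5.3)] -/
theorem coeff_lieSeries_X (p : ι → MvPolynomial ι 𝕜) (k : ℕ) (i : ι) :
    PowerSeries.coeff k (lieSeries (lieDerivation p) (MvPolynomial.X i)) = taylorPoly p k i :=
  coeff_lieSeries _ k _

end Polynomial

/-! ## §C. Evaluation over `ℝ`: the Taylor coefficient maps and the enclosure step -/

section Real

variable {ι : Type*} [Fintype ι]

/-- Evaluation of a vector of real polynomials: `evalVec q x = (qᵢ(x))ᵢ` (the right-hand side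
`f(y)` of `ẏ = f(y)`). [cite: HairerWannerLubich2002, §III.5.1 eq. (5.1)] -/
def evalVec (q : ι → MvPolynomial ι ℝ) (x : ι → ℝ) : ι → ℝ :=
  fun i => MvPolynomial.eval x (q i)

omit [Fintype ι] in
/-- Components of `evalVec`. [cite: HairerWannerLubich2002, §III.5.1 eq. (5.1)] -/
@[simp] theorem evalVec_apply (q : ι → MvPolynomial ι ℝ) (x : ι → ℝ) (i : ι) :
    evalVec q x i = MvPolynomial.eval x (q i) := rfl

/-- The Fréchet derivative `F'(y)` of `y ↦ F(y)` for one real polynomial `F = q`: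
`∑ⱼ (∂ⱼ q)(x) · projⱼ`. [cite: HairerWannerLubich2002, §III.5.1 eq. (5.2)] -/
def evalFDeriv (q : MvPolynomial ι ℝ) (x : ι → ℝ) : (ι → ℝ) →L[ℝ] ℝ :=
  ∑ j, MvPolynomial.eval x (MvPolynomial.pderiv j q) • ContinuousLinearMap.proj j

/-- `evalFDeriv q x v = ∑ⱼ (∂ⱼ q)(x) vⱼ` (directional derivative `F'(y) v`).
[cite: HairerWannerLubich2002, §III.5.1 eq. (5.2)] -/
theorem evalFDeriv_apply (q : MvPolynomial ι ℝ) (x v : ι → ℝ) :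
    evalFDeriv q x v = ∑ j, MvPolynomial.eval x (MvPolynomial.pderiv j q) * v j := by
  simp [evalFDeriv]

/-- **Polynomials are differentiable with the formal partial derivatives as gradient**:
`HasFDerivAt (x ↦ q(x)) (∑ⱼ (∂ⱼq)(x) projⱼ) x` — the derivative `F'(y)` in `(DF)(y) = F'(y) f(y)`.
[cite: HairerWannerLubich2002, §III.5.1 eq. (5.2)] -/
theorem hasFDerivAt_eval (q : MvPolynomial ι ℝ) (x : ι → ℝ) :
    HasFDerivAt (fun y : ι → ℝ => MvPolynomial.eval y q) (evalFDeriv q x) x := by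
  classical
  apply q.induction_on (fun a ↦ ?_) (fun p r hp hr ↦ ?_) fun p i hp ↦ ?_
  · have h0 : evalFDeriv (MvPolynomial.C a : MvPolynomial ι ℝ) x = 0 := by
      simp [evalFDeriv]
    rw [h0]
    simp_rw [MvPolynomial.eval_C]
    exact hasFDerivAt_const a x
  · have hadd : evalFDeriv (p + r) x = evalFDeriv p x + evalFDeriv r x := by
      simp [evalFDeriv, Finset.sum_add_distrib, add_smul]
    rw [hadd]
    simp_rw [map_add]
    exact hp.add hr
  · have hX : HasFDerivAt (fun y : ι → ℝ => y i) (ContinuousLinearMap.proj i) x :=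
      hasFDerivAt_apply (𝕜 := ℝ) i x
    have h := hp.mul hX
    simp_rw [map_mul, MvPolynomial.eval_X]
    refine h.congr_fderiv ?_
    ext v
    simp only [_root_.add_apply, _root_.smul_apply,
      ContinuousLinearMap.proj_apply, smul_eq_mul, evalFDeriv_apply, MvPolynomial.pderiv_mul,
      MvPolynomial.pderiv_X, map_add, map_mul, MvPolynomial.eval_X, add_mul,
      Finset.sum_add_distrib, Finset.mul_sum]
    have hs : ∑ j, MvPolynomial.eval x p *
        MvPolynomial.eval x (Pi.single (M := fun _ => MvPolynomial ι ℝ) j 1 i) * v j =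
        MvPolynomial.eval x p * v i := by
      rw [Finset.sum_eq_single i]
      · simp
      · intro j _ hji
        simp [Ne.symm hji]
      · intro hi; exact absurd (Finset.mem_univ i) hi
    rw [hs, add_comm]
    congr 1
    exact Finset.sum_congr rfl fun j _ => by ring

/-- The Fréchet derivative of `evalVec q`: `(evalVecFDeriv q x v)ᵢ = ∑ⱼ (∂ⱼ qᵢ)(x) vⱼ`, the
Jacobian of `q` at `x` applied to `v` (the Jacobians `∂f^[j]/∂y` of the HOE method).
[cite: NedialkovJacksonPryce2001, §3 (HOE existence test)] -/
def evalVecFDeriv (q : ι → MvPolynomial ι ℝ) (x : ι → ℝ) : (ι → ℝ) →L[ℝ] (ι → ℝ) :=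
  ContinuousLinearMap.pi fun i => evalFDeriv (q i) x

/-- Components of the formal Jacobian applied to a vector.
[cite: NedialkovJacksonPryce2001, §3 (HOE existence test, smoothness hypotheses on f^[j])] -/
@[simp] theorem evalVecFDeriv_apply (q : ι → MvPolynomial ι ℝ) (x v : ι → ℝ) (i : ι) :
    evalVecFDeriv q x v i = ∑ j, MvPolynomial.eval x (MvPolynomial.pderiv j (q i)) * v j := by
  simp [evalVecFDeriv, evalFDeriv_apply]

/-- `evalVec q` is Fréchet differentiable everywhere with derivative the formal Jacobian.
[cite: NedialkovJacksonPryce2001, §3 (HOE existence test, smoothness hypotheses on f^[j])] -/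
theorem hasFDerivAt_evalVec (q : ι → MvPolynomial ι ℝ) (x : ι → ℝ) :
    HasFDerivAt (evalVec q) (evalVecFDeriv q x) x :=
  hasFDerivAt_pi.2 fun i => hasFDerivAt_eval (q i) x

/-- `evalVec q` is continuous.
[cite: NedialkovJacksonPryce2001, §3 (HOE existence test, smoothness hypotheses on f^[j])] -/
theorem continuous_evalVec (q : ι → MvPolynomial ι ℝ) : Continuous (evalVec q) :=
  continuous_iff_continuousAt.2 fun x => (hasFDerivAt_evalVec q x).continuousAt

/-- **Chain-rule identity behind the coefficient recursion**: the Jacobian of `q` applied to the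
field `p` is the evaluation of the Lie derivative, `Dq(x) · p(x) = (L_p q)(x)`.
[cite: HairerWannerLubich2002, §III.5.1 eq. (5.2)] -/
theorem evalVecFDeriv_apply_evalVec (q p : ι → MvPolynomial ι ℝ) (x : ι → ℝ) :
    evalVecFDeriv q x (evalVec p x) = evalVec (fun i => lieDerivation p (q i)) x := by
  ext i
  rw [evalVecFDeriv_apply, evalVec_apply, lieDerivation_apply, map_sum]
  refine Finset.sum_congr rfl fun j _ => ?_
  rw [map_mul, evalVec_apply, mul_comm]

/-- The **Taylor coefficient maps** of the flow of the polynomial field `p`: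
`taylorMap p k x = (taylorPoly p k i (x))ᵢ = Φ k x` in the notation of
`highOrderEnclosure_step`. [cite: Moore1979, §3.4 eqs. (3.13)–(3.17)]
[cite: NedialkovJacksonCorliss1999, §5] -/
def taylorMap (p : ι → MvPolynomial ι ℝ) (k : ℕ) : (ι → ℝ) → ι → ℝ :=
  evalVec (taylorPoly p k)

/-- `Φ 0 = id` (hypothesis `hΦ0` of `highOrderEnclosure_step`; `(x)₀ = x(t₀)`).
[cite: Moore1979, §3.4 eq. (3.13)] -/
@[simp] theorem taylorMap_zero (p : ι → MvPolynomial ι ℝ) (x : ι → ℝ) : taylorMap p 0 x = x := by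
  ext i
  simp [taylorMap]

/-- `Φ 1 = p` (the field itself). [cite: Moore1979, §3.4 eq. (3.15)] -/
theorem taylorMap_one (p : ι → MvPolynomial ι ℝ) (x : ι → ℝ) : taylorMap p 1 x = evalVec p x := by
  ext i
  simp [taylorMap, taylorPoly_one]

/-- Differentiability of the Taylor coefficient maps with the formal Jacobian (hypothesis `hder`
of `highOrderEnclosure_step`, with `Ω = univ`).
[cite: NedialkovJacksonPryce2001, §3 (HOE existence test, smoothness hypotheses on f^[j])] -/
theorem hasFDerivAt_taylorMap (p : ι → MvPolynomial ι ℝ) (k : ℕ) (x : ι → ℝ) :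
    HasFDerivAt (taylorMap p k) (evalVecFDeriv (taylorPoly p k) x) x :=
  hasFDerivAt_evalVec _ x

/-- **The coefficient recursion as the chain-rule identity `hrec` of
`highOrderEnclosure_step`**: `DΦₖ(x) · p(x) = (k+1) · Φₖ₊₁(x)`.
[cite: Moore1979, §3.4 eq. (3.17)] [cite: NedialkovJacksonCorliss1999, §5] -/
theorem taylorMap_rec (p : ι → MvPolynomial ι ℝ) (k : ℕ) (x : ι → ℝ) :
    evalVecFDeriv (taylorPoly p k) x (evalVec p x) = ((k : ℝ) + 1) • taylorMap p (k + 1) x := by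
  rw [evalVecFDeriv_apply_evalVec]
  ext i
  rw [evalVec_apply, lieDerivation_taylorPoly, map_nsmul, nsmul_eq_mul, Pi.smul_apply,
    smul_eq_mul, taylorMap, evalVec_apply]
  push_cast
  ring

/-- Operator-norm bound for the formal Jacobian in terms of the evaluated partial derivatives
(sup norm on `ι → ℝ`; row-sum bound of an interval Jacobian). [cite: Neumaier1991, Cor. 5.1.5] -/
theorem norm_evalVecFDeriv_le (q : ι → MvPolynomial ι ℝ) (x : ι → ℝ) :
    ‖evalVecFDeriv q x‖ ≤ ∑ i, ∑ j, |MvPolynomial.eval x (MvPolynomial.pderiv j (q i))| := by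
  refine ContinuousLinearMap.opNorm_le_bound _ (by positivity) fun v => ?_
  rw [pi_norm_le_iff_of_nonneg (by positivity)]
  intro i
  rw [evalVecFDeriv_apply, Real.norm_eq_abs]
  calc |∑ j, MvPolynomial.eval x (MvPolynomial.pderiv j (q i)) * v j|
      ≤ ∑ j, |MvPolynomial.eval x (MvPolynomial.pderiv j (q i)) * v j| :=
        Finset.abs_sum_le_sum_abs _ _
    _ ≤ ∑ j, |MvPolynomial.eval x (MvPolynomial.pderiv j (q i))| * ‖v‖ := by
        refine Finset.sum_le_sum fun j _ => ?_
        rw [abs_mul]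
        refine mul_le_mul_of_nonneg_left ?_ (abs_nonneg _)
        rw [← Real.norm_eq_abs]
        exact norm_le_pi_norm v j
    _ = (∑ j, |MvPolynomial.eval x (MvPolynomial.pderiv j (q i))|) * ‖v‖ := by
        rw [Finset.sum_mul]
    _ ≤ (∑ i, ∑ j, |MvPolynomial.eval x (MvPolynomial.pderiv j (q i))|) * ‖v‖ := by
        refine mul_le_mul_of_nonneg_right ?_ (norm_nonneg _)
        exact Finset.single_le_sum (f := fun i => ∑ j,
          |MvPolynomial.eval x (MvPolynomial.pderiv j (q i))|)
          (fun i _ => by positivity) (Finset.mem_univ i)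

/-- **Bounded Jacobian on bounded sets** (hypothesis `hbd` of `highOrderEnclosure_step`): on a
bounded set the formal Jacobian of a polynomial map is uniformly bounded.
[cite: NedialkovJacksonPryce2001, §3 (HOE existence test, smoothness hypotheses on f^[j])] -/
theorem exists_bound_evalVecFDeriv (q : ι → MvPolynomial ι ℝ) {S : Set (ι → ℝ)}
    (hS : Bornology.IsBounded S) :
    ∃ C : ℝ, 0 ≤ C ∧ ∀ x ∈ S, ‖evalVecFDeriv q x‖ ≤ C := by
  set g : (ι → ℝ) → ℝ := fun x => ∑ i, ∑ j, |MvPolynomial.eval x (MvPolynomial.pderiv j (q i))|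
    with hg
  have hgc : Continuous g := by
    refine continuous_finsetSum _ fun i _ => continuous_finsetSum _ fun j _ => ?_
    exact (continuous_iff_continuousAt.2 fun x =>
      (hasFDerivAt_eval (MvPolynomial.pderiv j (q i)) x).continuousAt).abs
  obtain ⟨C, hC⟩ := hS.isCompact_closure.exists_bound_of_continuousOn hgc.continuousOn
  refine ⟨max C 0, le_max_right _ _, fun x hx => ?_⟩
  have h1 := norm_evalVecFDeriv_le q x
  have h2 : g x ≤ ‖g x‖ := Real.le_norm_self _
  have h3 := hC x (subset_closure hx)
  exact le_trans (le_trans (le_trans h1 h2) h3) (le_max_left _ _)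

/-- **Lipschitz on bounded convex sets** (hypotheses `hlipK`, `hloc` of
`highOrderEnclosure_step`): a polynomial map is Lipschitz on every bounded convex set, with the
derivative bound as constant (mean value inequality; a bound on the Jacobian over a convex set is
a Lipschitz constant). [cite: Neumaier1991, Prop. 5.1.4, Cor. 5.1.5] -/
theorem exists_lipschitzOnWith_evalVec (q : ι → MvPolynomial ι ℝ) {S : Set (ι → ℝ)}
    (hS : Bornology.IsBounded S) (hc : Convex ℝ S) :
    ∃ C : ℝ≥0, LipschitzOnWith C (evalVec q) S := by
  obtain ⟨C, hC0, hC⟩ := exists_bound_evalVecFDeriv q hS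
  refine ⟨⟨C, hC0⟩, hc.lipschitzOnWith_of_nnnorm_hasFDerivWithin_le
    (fun x _ => (hasFDerivAt_evalVec q x).hasFDerivWithinAt) fun x hx => ?_⟩
  rw [← NNReal.coe_le_coe, coe_nnnorm]
  exact hC x hx

/-- Local Lipschitz continuity of a polynomial field on closed balls (hypothesis `hloc` of
`highOrderEnclosure_step`). [cite: Neumaier1991, Prop. 5.1.4, Cor. 5.1.5] -/
theorem exists_lipschitzOnWith_evalVec_closedBall (q : ι → MvPolynomial ι ℝ) (ρ : ℝ) :
    ∃ C : ℝ≥0, LipschitzOnWith C (evalVec q) (closedBall 0 ρ) :=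
  exists_lipschitzOnWith_evalVec q isBounded_closedBall (convex_closedBall 0 ρ)

/-- **Lohner's constant high-order enclosure step for a polynomial vector field, with all
analytic side conditions discharged.**  For `y' = p(y)`, `p` polynomial, order `K ≥ 1`, a
bounded convex candidate set `S`, an a-priori box `[c, d] ⊇ Φ_K(S)` for the `K`-th Taylor
coefficient map `Φ_K = taylorMap p K`, and the inclusion test
`∑_{j<K} tʲ Φⱼ(y₀) + t^K [c, d] ⊆ S` on `[0, h]` for all `y₀ ∈ W`: every `y₀ ∈ W` has a solution on
`[0, h]`, and every solution from `y₀` stays in `S` and in the Taylor-model tube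
`∑_{j<K} tʲ Φⱼ(y₀) + t^K [c, d]`.  The Taylor coefficient maps are generated by Moore's
recurrences (`taylorPoly_succ`, `lieCoeff_add`, `lieCoeff_mul`); differentiability, the
chain-rule recursion `hrec`, the derivative bound and the Lipschitz hypotheses of
`highOrderEnclosure_step` are theorems of this file.
[cite: NedialkovJacksonPryce2001, §3 (HOE existence test)] [cite: Moore1979, §3.4]
[cite: NedialkovJacksonCorliss1999, §5 Algorithm I] -/
theorem highOrderEnclosure_step_polynomial (p : ι → MvPolynomial ι ℝ) {S W : Set (ι → ℝ)}
    {K : ℕ} (hK : 0 < K) {c d : ι → ℝ} {h : ℝ}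
    (hSb : Bornology.IsBounded S) (hSc : Convex ℝ S) (hcd : c ≤ d)
    (hKS : MapsTo (taylorMap p K) S (Icc c d)) (hh : 0 ≤ h)
    (hincl : ∀ y₀ ∈ W, ∀ t ∈ Icc 0 h, ∀ v ∈ Icc c d,
      (∑ j ∈ Finset.range K, t ^ j • taylorMap p j y₀) + t ^ K • v ∈ S)
    {y₀ : ι → ℝ} (hy₀ : y₀ ∈ W) :
    (∃ y : ℝ → ι → ℝ, y 0 = y₀ ∧
        ∀ t ∈ Icc 0 h, HasDerivWithinAt y (evalVec p (y t)) (Icc 0 h) t) ∧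
      ∀ z : ℝ → ι → ℝ, z 0 = y₀ →
        (∀ t ∈ Icc 0 h, HasDerivWithinAt z (evalVec p (z t)) (Icc 0 h) t) →
          ∀ t ∈ Icc 0 h, z t ∈ S ∧ ∃ v ∈ Icc c d,
            z t = (∑ j ∈ Finset.range K, t ^ j • taylorMap p j y₀) + t ^ K • v := by
  -- uniform derivative bound for the finitely many maps `Φ 0, …, Φ (K-1)` on `S`
  choose B hB0 hB using fun j : ℕ => exists_bound_evalVecFDeriv (taylorPoly p j) hSb
  obtain ⟨L, hL⟩ := exists_lipschitzOnWith_evalVec (taylorPoly p K) hSb hSc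
  refine highOrderEnclosure_step (f := evalVec p) (Φ := taylorMap p)
    (Φ' := fun j x => evalVecFDeriv (taylorPoly p j) x) (Ω := Set.univ)
    (B := ∑ j ∈ Finset.range K, B j) hK (subset_univ S) (taylorMap_zero p)
    (fun j _ x _ => hasFDerivAt_taylorMap p j x) (fun j _ x _ => taylorMap_rec p j x)
    (fun j hj x hx => ?_) hL hcd hKS hh
    (fun ρ => exists_lipschitzOnWith_evalVec_closedBall p ρ) hincl hy₀
  exact le_trans (hB j x hx)
    (Finset.single_le_sum (f := B) (fun i _ => hB0 i) (Finset.mem_range.2 hj))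

end Real

end Literature.Analysis.ODE

end
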